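import Literature.Geometry.Symplectic.NearSymplecticZeroCircles
import Literature.Geometry.Symplectic.HondaUntwistedModel
import Literature.Geometry.Riemannian.ClosedCurveTubularMap
import HarnessLib

/-!
# Tubular charts `ℝ⁴ ⊃ ℝ × B³(r) → M` along a zero circle of a 2-form on an oriented 4-manifold

Topic `Literature/Geometry/Symplectic`.  The geometric half of Honda's local model at an
(untwisted) zero circle (Honda, *Local properties of self-dual harmonic 2-forms on a 4-manifold*
(2004), §2, proof of Thm. 5; Perutz, *Zero-sets of near-symplectic forms* (2006), §3, Lemma 3.1:
"identify a neighbourhood of `Z` with `S¹ × D³`"): for a zero circle `γ` (`IsZeroCircle α γ`: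
`2π`-periodic `C^∞` immersed loop, injective modulo `2π`) in an oriented `4`-manifold `M` and an
open `N ⊇ γ(ℝ)`, there is a map `χ : ℝ⁴ → M`, `2π`-periodic in the first coordinate, which on the
model tube `hondaTube r = {x₁² + x₂² + x₃² < r²}` is `C^∞`, an immersion, injective modulo
`2πℤ e₀`, with image in `N`, restricting on the axis to `χ(θ, 0, 0, 0) = γ θ` (so
`χ(hondaAxis) = γ(ℝ)`), and whose differential on the axis is
`u ↦ u₀ γ'(θ) + ∑ u_{a+1} ν_{a+1}(θ)` for a `2π`-periodic `C^∞` frame `ν` along `γ`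
(`IsZeroCircle.exists_tubularChart`).  These are exactly the chart clauses of
`IsHondaModelChartIn N r · χ` (`NearSymplecticTwoCirclesReduction.lean`); the remaining clause,
`χ* sf = ω_A`, is the analytic half of Honda's theorem.

Proof: `Riemannian/ClosedCurveTubularMap.exists_tubularMap_of_closedCurve` composed with the linear
isomorphism `ℝ⁴ ≅ ℝ × ℝ³`, `q ↦ (q₀, (q₁, q₂, q₃))`, plus a tube-lemma shrinking of the radius to
land in `N`.  Everything is proved; no definitions, no named facts.

## References

* K. Honda, *Local properties of self-dual harmonic 2-forms on a 4-manifold*, J. reine angew.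
  Math. 577 (2004), §2, Thm. 5 (proof). [Honda2004LocalSD]
* T. Perutz, *Zero-sets of near-symplectic forms*, J. Symplectic Geom. 4 (2006), Lemma 3.1.
  [Perutz2006]
* M. W. Hirsch, *Differential Topology*, GTM 33 (1976), Ch. 4, §5, Thm. 5.2. [HirschDT1976]
-/

noncomputable section

open scoped Manifold ContDiff Topology Real
open Set Function Bundle Filter Module Metric Literature.Topology.FourManifolds
  Literature.Geometry.Riemannian Literature.Geometry.Lorentzian Literature.Geometry.Kaehler

namespace Literature.Geometry.Symplectic

universe u

variable {M : Type u} [TopologicalSpace M] [ChartedSpace (EuclideanSpace ℝ (Fin 4)) M]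
  [IsManifold (𝓡 4) ∞ M] [T2Space M] [SigmaCompactSpace M]

/-- The coordinate splitting `ℝ⁴ → ℝ × ℝ³`, `q ↦ (q₀, (q₁, q₂, q₃))`, as a continuous linear map
(used only inside this file's proofs, through its defining formula). [folklore] -/
theorem exists_splitCLM :
    ∃ L : EuclideanSpace ℝ (Fin 4) →L[ℝ] ℝ × (Fin 3 → ℝ),
      ∀ q, L q = (q 0, fun a : Fin 3 ↦ q a.succ) :=
  ⟨(EuclideanSpace.proj (0 : Fin 4)).prod
      (ContinuousLinearMap.pi fun a : Fin 3 ↦ EuclideanSpace.proj (𝕜 := ℝ) a.succ),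
    fun _ ↦ rfl⟩

/-- On the model tube the `ℝ³`-part has sup-norm `< r`. [folklore] -/
theorem norm_tail_lt_of_mem_hondaTube {r : ℝ} (hr : 0 < r) {q : EuclideanSpace ℝ (Fin 4)}
    (hq : q ∈ hondaTube r) : ‖(fun a : Fin 3 ↦ q a.succ)‖ < r := by
  rw [mem_hondaTube] at hq
  rw [pi_norm_lt_iff hr]
  intro a
  rw [Real.norm_eq_abs, ← abs_of_pos hr, ← sq_lt_sq]
  fin_cases a
  · show q 1 ^ 2 < r ^ 2; nlinarith [sq_nonneg (q 2), sq_nonneg (q 3)]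
  · show q 2 ^ 2 < r ^ 2; nlinarith [sq_nonneg (q 1), sq_nonneg (q 3)]
  · show q 3 ^ 2 < r ^ 2; nlinarith [sq_nonneg (q 1), sq_nonneg (q 2)]

/-- **Tubular chart along a zero circle** (Honda 2004, proof of Thm. 5; Perutz 2006, Lemma 3.1;
Hirsch 1976, Ch. 4 Thm. 5.2).  For a zero circle `γ` of `α` in an oriented `4`-manifold and an
open `N ⊇ γ(ℝ)`: a `2π`-periodic `C^∞` frame `ν` along `γ` (linearly independent,
`ν₀ = c γ'`, `c > 0`), a radius `r > 0` and `χ : ℝ⁴ → M`, `2π`-periodic in `e₀`, such that on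
`hondaTube r` the map `χ` is `C^∞`, immersive and injective modulo `2πℤ e₀`, `χ(hondaTube r) ⊆ N`,
`χ q = γ(q₀)` on the axis (hence `χ(hondaAxis) = γ(ℝ)`), and on the axis
`dχ_q(u) = u₀ γ'(q₀) + ∑ₐ u_{a+1} ν_{a+1}(q₀)`. [cite: Honda2004LocalSD, Thm. 5 (proof)] -/
theorem IsZeroCircle.exists_tubularChart (o : SmoothOrientation (𝓡 4) M)
    {α : MForm (𝓡 4) M ℝ 2} {γ : ℝ → M} (h : IsZeroCircle α γ) {N : Set M} (hN : IsOpen N)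
    (hγN : range γ ⊆ N) :
    ∃ (ν : Fin 4 → Π t : ℝ, TangentSpace (𝓡 4) (γ t)) (r : ℝ) (χ : EuclideanSpace ℝ (Fin 4) → M),
      (∀ i, ContMDiff 𝓘(ℝ, ℝ) (𝓡 4).tangent ∞ (fun t ↦
        (TotalSpace.mk' (EuclideanSpace ℝ (Fin 4)) (γ t) (ν i t) : TangentBundle (𝓡 4) M))) ∧
      (∀ i t, ν i (t + 2 * π) = ν i t) ∧
      (∀ t, LinearIndependent ℝ fun i ↦ (ν i t : EuclideanSpace ℝ (Fin 4))) ∧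
      (∀ t, ∃ c : ℝ, 0 < c ∧ ν 0 t = c • velocity (𝓡 4) γ t) ∧
      0 < r ∧
      (∀ q, χ (q + (2 * π) • EuclideanSpace.single 0 1) = χ q) ∧
      ContMDiffOn 𝓘(ℝ, EuclideanSpace ℝ (Fin 4)) (𝓡 4) ∞ χ (hondaTube r) ∧
      (∀ q ∈ hondaTube r, ∀ q' ∈ hondaTube r, χ q' = χ q →
        ∃ k : ℤ, q' = q + (2 * π * k) • EuclideanSpace.single 0 1) ∧
      (∀ q ∈ hondaTube r, Injective (mfderiv 𝓘(ℝ, EuclideanSpace ℝ (Fin 4)) (𝓡 4) χ q)) ∧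
      χ '' hondaTube r ⊆ N ∧
      (∀ q ∈ hondaAxis, χ q = γ (q 0)) ∧
      χ '' hondaAxis = range γ ∧
      (∀ q ∈ hondaAxis, ∀ u : EuclideanSpace ℝ (Fin 4),
        mfderiv 𝓘(ℝ, EuclideanSpace ℝ (Fin 4)) (𝓡 4) χ q u =
          u 0 • velocity (𝓡 4) γ (q 0) + ∑ a : Fin 3, u a.succ • ν a.succ (q 0)) := by
  classical
  -- hypotheses of the closed-curve tubular map
  have hT : (0 : ℝ) < 2 * π := by positivity
  have hvel : ∀ t, velocity (𝓡 4) γ t ≠ 0 := fun t ↦ h.zeroCircleTangent_ne_zero t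
  have hinjT : ∀ θ θ' : ℝ, γ θ = γ θ' → ∃ k : ℤ, θ' = θ + k * (2 * π) := by
    intro θ θ' hθ
    obtain ⟨k, hk⟩ := h.eq_add_of_eq θ θ' hθ.symm
    exact ⟨k, by rw [hk]; ring⟩
  have hE : finrank ℝ (EuclideanSpace ℝ (Fin 4)) = 4 := finrank_euclideanSpace_fin
  obtain ⟨χ, ν, r, hsm, hνper, hli, hν0, hr, hχper, hχ0, hdχ0, hreg, hinj⟩ :=
    exists_tubularMap_of_closedCurve (I := 𝓡 4) hE o h.contMDiff hT h.periodic hvel hinjT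
  -- integer periods of `χ`
  have hχperZ : ∀ θ (x : Fin 3 → ℝ) (k : ℤ), χ (θ + k • (2 * π), x) = χ (θ, x) := fun θ x k ↦
    periodic_zsmul (γ := fun θ ↦ χ (θ, x)) (fun θ ↦ hχper θ x) θ k
  -- (1) shrink the radius so that the tube maps into `N`
  set V : Set (ℝ × (Fin 3 → ℝ)) := {q | χ ⁻¹' N ∈ 𝓝 q} with hV
  have hVo : IsOpen V := by
    simp only [hV, ← mem_interior_iff_mem_nhds, setOf_mem_eq]; exact isOpen_interior
  have hsub : Icc 0 (2 * π) ×ˢ ({0} : Set (Fin 3 → ℝ)) ⊆ V := by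
    rintro ⟨θ, x⟩ ⟨-, hx⟩
    rw [mem_singleton_iff] at hx
    subst hx
    have hc : ContinuousAt χ (θ, 0) := (hreg (θ, 0) (by simpa using hr)).1.continuousAt
    exact hc.preimage_mem_nhds (hN.mem_nhds (by rw [hχ0]; exact hγN ⟨θ, rfl⟩))
  obtain ⟨u, v, -, hv, hIu, h0v, huv⟩ :=
    generalized_tube_lemma isCompact_Icc isCompact_singleton hVo hsub
  obtain ⟨r₃, hr₃, hball⟩ := Metric.isOpen_iff.1 hv 0 (h0v rfl)
  have hN_of : ∀ θ (x : Fin 3 → ℝ), ‖x‖ < r₃ → χ (θ, x) ∈ N := by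
    intro θ x hx
    set k := toIcoDiv hT 0 θ with hk
    have hθ' : θ - k • (2 * π) ∈ Ico 0 (2 * π) := sub_toIcoDiv_zsmul_mem_Ico hT θ
    have hmem : (θ - k • (2 * π), x) ∈ V :=
      huv ⟨hIu (Ico_subset_Icc_self hθ'), hball (by simpa using hx)⟩
    have h1 : (θ - k • (2 * π), x) ∈ χ ⁻¹' N := mem_of_mem_nhds hmem
    rw [mem_preimage] at h1
    have h2 := hχperZ (θ - k • (2 * π)) x k
    rw [sub_add_cancel] at h2
    rw [h2]
    exact h1
  -- (2) the chart on `ℝ⁴`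
  obtain ⟨L, hL⟩ := exists_splitCLM
  set ρ : ℝ := min r r₃ with hρ
  have hρ0 : 0 < ρ := lt_min hr hr₃
  set χ' : EuclideanSpace ℝ (Fin 4) → M := fun q ↦ χ (L q) with hχ'
  have hχ'_apply : ∀ q, χ' q = χ (q 0, fun a : Fin 3 ↦ q a.succ) := fun q ↦ by
    show χ (L q) = _; rw [hL]
  have htail : ∀ q ∈ hondaTube ρ, ‖(fun a : Fin 3 ↦ q a.succ)‖ < r := fun q hq ↦
    lt_of_lt_of_le (norm_tail_lt_of_mem_hondaTube hρ0 hq) (min_le_left _ _)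
  have htail₃ : ∀ q ∈ hondaTube ρ, ‖(fun a : Fin 3 ↦ q a.succ)‖ < r₃ := fun q hq ↦
    lt_of_lt_of_le (norm_tail_lt_of_mem_hondaTube hρ0 hq) (min_le_right _ _)
  -- differential of `χ'`: chain rule through the linear map `L`
  have hLd : ∀ q, HasMFDerivAt 𝓘(ℝ, EuclideanSpace ℝ (Fin 4)) (𝓘(ℝ, ℝ).prod 𝓘(ℝ, Fin 3 → ℝ))
      (fun q : EuclideanSpace ℝ (Fin 4) ↦ ((q 0 : ℝ), fun a : Fin 3 ↦ q a.succ)) q L := by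
    intro q
    have h1 := (EuclideanSpace.proj (𝕜 := ℝ) (0 : Fin 4)).hasMFDerivAt (x := q)
    have h2 := (ContinuousLinearMap.pi fun a : Fin 3 ↦
      EuclideanSpace.proj (𝕜 := ℝ) (Fin.succ a : Fin 4)).hasMFDerivAt (x := q)
    have h3 := h1.prodMk h2
    have hLeq : L = (EuclideanSpace.proj (𝕜 := ℝ) (0 : Fin 4)).prod
        (ContinuousLinearMap.pi fun a : Fin 3 ↦ EuclideanSpace.proj (𝕜 := ℝ) (Fin.succ a : Fin 4)) := by
      ext q <;> simp [hL]
    rw [hLeq]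
    exact h3
  have hmf : ∀ q ∈ hondaTube ρ, mfderiv 𝓘(ℝ, EuclideanSpace ℝ (Fin 4)) (𝓡 4) χ' q =
      (mfderiv (𝓘(ℝ, ℝ).prod 𝓘(ℝ, Fin 3 → ℝ)) (𝓡 4) χ (q 0, fun a : Fin 3 ↦ q a.succ)).comp L := by
    intro q hq
    have hd : MDifferentiableAt (𝓘(ℝ, ℝ).prod 𝓘(ℝ, Fin 3 → ℝ)) (𝓡 4) χ
        (q 0, fun a : Fin 3 ↦ q a.succ) :=
      (hreg _ (htail q hq)).1.mdifferentiableAt (by simp)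
    have hc := hd.hasMFDerivAt.comp q (hLd q)
    have hfun : χ' = χ ∘ fun q : EuclideanSpace ℝ (Fin 4) ↦ ((q 0 : ℝ), fun a : Fin 3 ↦ q a.succ) :=
      funext fun q ↦ hχ'_apply q
    rw [hfun]
    exact hc.mfderiv
  have hLinj : Injective L := by
    intro q q' hqq'
    rw [hL, hL, Prod.mk.injEq] at hqq'
    ext i
    refine Fin.cases ?_ (fun a ↦ ?_) i
    · exact hqq'.1
    · exact congrFun hqq'.2 a
  refine ⟨ν, ρ, χ', hsm, hνper, hli, hν0, hρ0, fun q ↦ ?_, fun q hq ↦ ?_, fun q hq q' hq' hqq' ↦ ?_,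
    fun q hq ↦ ?_, ?_, fun q hq ↦ ?_, ?_, fun q hq w ↦ ?_⟩
  · -- periodicity in `e₀`
    rw [hχ'_apply, hχ'_apply]
    have h0 : (q + (2 * π) • EuclideanSpace.single (0 : Fin 4) (1 : ℝ)) 0 = q 0 + 2 * π := by simp
    have hs : (fun a : Fin 3 ↦ (q + (2 * π) • EuclideanSpace.single (0 : Fin 4) (1 : ℝ)) a.succ) =
        fun a : Fin 3 ↦ q a.succ := by
      funext a; simp [Fin.succ_ne_zero]
    rw [h0, hs, hχper]
  · -- smoothness on the tube
    refine ContMDiffAt.contMDiffWithinAt ?_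
    have hfun : χ' = χ ∘ fun q : EuclideanSpace ℝ (Fin 4) ↦
        ((q 0 : ℝ), fun a : Fin 3 ↦ q a.succ) := funext fun q ↦ hχ'_apply q
    have hA : ContMDiffAt 𝓘(ℝ, EuclideanSpace ℝ (Fin 4)) (𝓘(ℝ, ℝ).prod 𝓘(ℝ, Fin 3 → ℝ)) ∞
        (fun q : EuclideanSpace ℝ (Fin 4) ↦ ((q 0 : ℝ), fun a : Fin 3 ↦ q a.succ)) q :=
      ((EuclideanSpace.proj (𝕜 := ℝ) (0 : Fin 4)).contMDiff q).prodMk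
        ((ContinuousLinearMap.pi fun a : Fin 3 ↦
          EuclideanSpace.proj (𝕜 := ℝ) (Fin.succ a : Fin 4)).contMDiff q)
    rw [hfun]
    exact (hreg _ (htail q hq)).1.comp q hA
  · -- injectivity modulo `2πℤ e₀`
    rw [hχ'_apply, hχ'_apply] at hqq'
    obtain ⟨hx, k, hk⟩ := hinj (q 0) (q' 0) _ _ (htail q hq) (htail q' hq') hqq'.symm
    refine ⟨k, ?_⟩
    ext i
    refine Fin.cases ?_ (fun a ↦ ?_) i
    · simp [hk]; ring
    · have := congrFun hx a
      simp [Fin.succ_ne_zero]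
      exact this.symm
  · -- immersion
    rw [hmf q hq]
    exact (hreg _ (htail q hq)).2.comp hLinj
  · -- image in `N`
    rintro _ ⟨q, hq, rfl⟩
    rw [hχ'_apply]
    exact hN_of _ _ (htail₃ q hq)
  · -- the axis
    rw [hχ'_apply]
    obtain ⟨h1, h2, h3⟩ := mem_hondaAxis.1 hq
    have : (fun a : Fin 3 ↦ q a.succ) = 0 := by
      funext a; fin_cases a
      · exact h1
      · exact h2
      · exact h3
    rw [this, hχ0]
  · -- `χ (hondaAxis) = range γ`
    apply Subset.antisymm
    · rintro _ ⟨q, hq, rfl⟩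
      obtain ⟨h1, h2, h3⟩ := mem_hondaAxis.1 hq
      refine ⟨q 0, ?_⟩
      rw [hχ'_apply]
      have : (fun a : Fin 3 ↦ q a.succ) = 0 := by
        funext a; fin_cases a
        · exact h1
        · exact h2
        · exact h3
      rw [this, hχ0]
    · rintro _ ⟨θ, rfl⟩
      refine ⟨θ • EuclideanSpace.single (0 : Fin 4) (1 : ℝ), by simp [mem_hondaAxis], ?_⟩
      rw [hχ'_apply]
      have : (fun a : Fin 3 ↦ (θ • EuclideanSpace.single (0 : Fin 4) (1 : ℝ)) a.succ) = 0 := by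
        funext a; simp [Fin.succ_ne_zero]
      rw [this]
      simp [hχ0]
  · -- differential on the axis
    have hq' : q ∈ hondaTube ρ := hondaAxis_subset_hondaTube hρ0 hq
    obtain ⟨h1, h2, h3⟩ := mem_hondaAxis.1 hq
    have htl : (fun a : Fin 3 ↦ q a.succ) = 0 := by
      funext a; fin_cases a
      · exact h1
      · exact h2
      · exact h3
    have key : ∀ p₁ p₂ : ℝ × (Fin 3 → ℝ), p₁ = p₂ → ∀ v : ℝ × (Fin 3 → ℝ),
        (mfderiv (𝓘(ℝ, ℝ).prod 𝓘(ℝ, Fin 3 → ℝ)) (𝓡 4) χ p₁ v : EuclideanSpace ℝ (Fin 4)) =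
          mfderiv (𝓘(ℝ, ℝ).prod 𝓘(ℝ, Fin 3 → ℝ)) (𝓡 4) χ p₂ v := by
      intro p₁ p₂ hp v; subst hp; rfl
    rw [hmf q hq']
    show (mfderiv (𝓘(ℝ, ℝ).prod 𝓘(ℝ, Fin 3 → ℝ)) (𝓡 4) χ (q 0, fun a : Fin 3 ↦ q a.succ)) (L w) = _
    rw [key _ ((q 0 : ℝ), (0 : Fin 3 → ℝ)) (by rw [htl]) (L w), hdχ0, hL]

end Literature.Geometry.Symplectic

end
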